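import Summits.ABC.IUTFork.LDHSplitBadWitnessLocus
import Summits.ABC.IUTFork.LDHSplitPlaceArithmetic
import HarnessLib

/-!
# The fork at [IUTchIII] Corollary 3.12, L-DH level: a LOPSIDED point family on the `λ`-line over `ℚ(i)` —
# I. `λ_k = π^{2k}/(2π^{2k} + 1)`, `π = 2 + i`: one-sided depth `2k` at the split prime `5`

Proof-only file (D-0012; 0 definitions, no `Prop` fact) of the abc-iut cell (seat abc-iut-w5-d126, gen 5; row
«HABOVE-LOPSIDED-WITNESS», crux `ThetaPartII` = stmt-ABC-19678, (U) line, VERDICT RISK ¶7). TAKES NO SIDE on [IUTchIII]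
Cor. 3.12 or [IUTchIV] Thm. 1.10; its content is classical arithmetic of the `λ`-line over `ℚ(i)`.
S. Mochizuki, *IUT IV* [Mochizuki2012], Cor. 2.2 (ii) proof pp. 45–46 ((P2), (P5)); K. Ireland, M. Rosen [IrelandRosen1982],
Ch. 9 §7 p. 120 (`ℤ[i]`, `N(a + bi) = a² + b²`, `5 = (2+i)(2−i)`); Dupuy–Hilado [DupuyHilado2025] §2.4.2, §3.6.

WHY. abc-iut-S4's necessary condition of the registered (U)-stub `stub_hullRegimeAbove` (p447630,
`ThetaPartII.pair_le_slack_of_stub_hullRegimeAbove`) is an explicit pair inequality whose (log-diff + log-cond)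
coefficient is `l`-INDEPENDENT while the pair term grows like `l²·μ(v)`; a point of a QUADRATIC field with a deep pole of
`j(λ)` at ONE place over a split prime and good reduction at the conjugate place violates it for large `l`. This series
constructs such points over any model `F` of `ℚ(i)` (`ζ ∈ 𝓞 F` a primitive fourth root of unity, `π := 2 + ζ`):

  `λ_k := π^{2k} / (2·π^{2k} + 1)`, `k ≥ 1`.

THIS FILE (places and congruences): `π·π̄ = 5`, `π` is not a unit, so a finite place `V ∋ π` exists; it lies over `5`,
contains neither `2`, `3` nor `π̄ = 2 − ζ`, and every place `W ∋ π̄` (e.g. the conjugate place `V̄`, complex conjugation `τ`,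
`τζ = −ζ`) satisfies `π^{2k} − 1 ∈ W` (`π² − 1 = 2(5 − 2π̄)`), so `a = π^{2k}`, `b = 2π^{2k} + 1`, `c = π^{2k} + 1 ∉ W`, while
`b, c ∉ V`; `λ_k ≠ 0, 1`, `1 − λ_k = c/b`, `λ_k − 1/2 = −1/(2b)`. Part II (`LDHLopsidedWitnessOrders`) reads off the orders of
`j(λ_k)` at `V`, `W` and the local-height budget at every place. HONEST SCOPE: classical; nothing asserted about print. [cite: IrelandRosen1982, Ch. 9 §7 p. 120]
[cite: DupuyHilado2025, §2.4.2, §3.6] [claim: Mochizuki2012, status: disputed] for every IUT locator quoted.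
-/

noncomputable section

namespace Summit.ABC.IUTFork

namespace LopsidedWitness

open NumberField IsDedekindDomain Metric Finset
open Literature.IUT.LogVolume Literature.IUT.LogVolume.Cor22
open Literature.NumberTheory.DiophantineGeometry Literature.NumberTheory.DiophantineGeometry.GenEll
open Literature.NumberTheory.NumberFields
open SplitBadWitness

variable {F : Type} [Field F] [NumberField F] {ζ : 𝓞 F}

/-! ## Algebra of `π = 2 + i`, `π̄ = 2 − i` -/

omit [NumberField F] in
/-- `i² = −1` in `𝓞 F`. [cite: IrelandRosen1982, Ch. 9 §7 p. 120] -/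
theorem zeta_sq (hζ : IsPrimitiveRoot ζ 4) : ζ ^ 2 = -1 :=
  (hζ.pow (by norm_num) (by norm_num : 4 = 2 * 2)).eq_neg_one_of_two_right

omit [NumberField F] in
/-- `π·π̄ = (2 + i)(2 − i) = 5` in `𝓞 F`. [cite: IrelandRosen1982, Ch. 9 §7 p. 120] -/
theorem pi_mul_piBar (hζ : IsPrimitiveRoot ζ 4) : (2 + ζ) * (2 - ζ) = (5 : 𝓞 F) := by
  have h : (2 + ζ) * (2 - ζ) = 4 - ζ ^ 2 := by ring
  rw [h, zeta_sq hζ]; norm_num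

omit [NumberField F] in
/-- `π² − 1 = 2·(5 − 2π̄)`. [cite: IrelandRosen1982, Ch. 9 §7 p. 120] -/
theorem pi_sq_sub_one (hζ : IsPrimitiveRoot ζ 4) : (2 + ζ) ^ 2 - 1 = (2 : 𝓞 F) * (5 - 2 * (2 - ζ)) := by
  have h : (2 + ζ) ^ 2 - 1 = 3 + 4 * ζ + ζ ^ 2 := by ring
  rw [h, zeta_sq hζ]; ring

omit [NumberField F] in
/-- Coercions to the field. [cite: IrelandRosen1982, Ch. 9 §7 p. 120] -/
theorem coe_pi_pow (ζ : 𝓞 F) (n : ℕ) : (((2 + ζ) ^ n : 𝓞 F) : F) = (2 + (ζ : F)) ^ n := by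
  simp only [RingOfIntegers.coe_eq_algebraMap, map_add, map_pow, map_ofNat]

omit [NumberField F] in
/-- Coercion of `b = 2π^n + 1`. [cite: IrelandRosen1982, Ch. 9 §7 p. 120] -/
theorem coe_b (ζ : 𝓞 F) (n : ℕ) : (((2 * (2 + ζ) ^ n + 1 : 𝓞 F)) : F) = 2 * (2 + (ζ : F)) ^ n + 1 := by
  simp only [RingOfIntegers.coe_eq_algebraMap, map_add, map_mul, map_one, map_pow, map_ofNat]

omit [NumberField F] in
/-- Coercion of `c = π^n + 1`. [cite: IrelandRosen1982, Ch. 9 §7 p. 120] -/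
theorem coe_c (ζ : 𝓞 F) (n : ℕ) : ((((2 + ζ) ^ n + 1 : 𝓞 F)) : F) = (2 + (ζ : F)) ^ n + 1 := by
  simp only [RingOfIntegers.coe_eq_algebraMap, map_add, map_one, map_pow, map_ofNat]

/-- `π = 2 + i ≠ 0` in the field (`i = −2` would give `i² = 4`). [cite: IrelandRosen1982, Ch. 9 §7 p. 120] -/
theorem piF_ne_zero (hζ : IsPrimitiveRoot ζ 4) : (2 + (ζ : F)) ≠ 0 := by
  intro h
  have h1 : (ζ : F) = -2 := by linear_combination h
  have h2 := coe_sq hζ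
  rw [h1] at h2
  norm_num at h2

/-- `π = 2 + i` is not a unit of `ℤ[i]` (`N(π) = 5`). [cite: IrelandRosen1982, Ch. 9 §7 p. 120] -/
theorem not_isUnit_pi [IsCyclotomicExtension {4} ℚ F] (hζ : IsPrimitiveRoot ζ 4) : ¬ IsUnit (2 + ζ : 𝓞 F) := by
  rw [isUnit_iff_norm_eq_one_four]
  have h := norm_int_add_int_mul_four hζ 2 1
  have e1 : ((2 : ℤ) : 𝓞 F) + ((1 : ℤ) : 𝓞 F) * ζ = 2 + ζ := by push_cast; ring
  rw [e1] at h
  rw [h]; norm_num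

/-! ## A place `V ∋ π` over `5` -/

/-- **There is a finite place `V ∋ π`.** [cite: IrelandRosen1982, Ch. 9 §7 p. 120] -/
theorem exists_place_pi [IsCyclotomicExtension {4} ℚ F] (hζ : IsPrimitiveRoot ζ 4) :
    ∃ V : HeightOneSpectrum (𝓞 F), (2 + ζ : 𝓞 F) ∈ V.asIdeal := by
  obtain ⟨M, hM, hle⟩ := Ideal.exists_le_maximal _ (Ideal.span_singleton_ne_top (not_isUnit_pi hζ))
  have hmem : (2 + ζ : 𝓞 F) ∈ M := hle (Ideal.mem_span_singleton_self _)
  refine ⟨⟨M, hM.isPrime, fun hbot => ?_⟩, hmem⟩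
  rw [hbot, Ideal.mem_bot] at hmem
  exact piF_ne_zero hζ (by rw [← map_ofNat (algebraMap (𝓞 F) F) 2, ← map_add, hmem, map_zero])

omit [NumberField F] in
/-- `5 ∈ V` for a place `V ∋ π`. [cite: IrelandRosen1982, Ch. 9 §7 p. 120] -/
theorem five_mem (hζ : IsPrimitiveRoot ζ 4) {V : HeightOneSpectrum (𝓞 F)} (hV : (2 + ζ : 𝓞 F) ∈ V.asIdeal) :
    (5 : 𝓞 F) ∈ V.asIdeal := by
  rw [← pi_mul_piBar hζ]; exact V.asIdeal.mul_mem_right _ hV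

omit [NumberField F] in
/-- `5 ∈ W` for a place `W ∋ π̄`. [cite: IrelandRosen1982, Ch. 9 §7 p. 120] -/
theorem five_mem' (hζ : IsPrimitiveRoot ζ 4) {W : HeightOneSpectrum (𝓞 F)} (hW : (2 - ζ : 𝓞 F) ∈ W.asIdeal) :
    (5 : 𝓞 F) ∈ W.asIdeal := by
  rw [← pi_mul_piBar hζ]; exact W.asIdeal.mul_mem_left _ hW

/-- A place containing `5` lies over `5`. [cite: DupuyHilado2025, §2.5.4] -/
theorem mem_placesOver_five {V : HeightOneSpectrum (𝓞 F)} (hV : (5 : 𝓞 F) ∈ V.asIdeal) :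
    haveI : Fact (Nat.Prime 5) := ⟨by norm_num⟩
    V ∈ placesOver F 5 := by
  haveI : Fact (Nat.Prime 5) := ⟨by norm_num⟩
  exact mem_placesOver_of_natCast_mem 5 V (by exact_mod_cast hV)

omit [NumberField F] in
/-- A place containing `5` does not contain `2`. [cite: DupuyHilado2025, §2.5.4] -/
theorem two_notMem {V : HeightOneSpectrum (𝓞 F)} (hV : (5 : 𝓞 F) ∈ V.asIdeal) : (2 : 𝓞 F) ∉ V.asIdeal := by
  intro h2
  apply V.isPrime.ne_top
  rw [Ideal.eq_top_iff_one]
  have : (1 : 𝓞 F) = 5 - 2 * 2 := by norm_num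
  rw [this]
  exact V.asIdeal.sub_mem hV (V.asIdeal.mul_mem_left _ h2)

omit [NumberField F] in
/-- A place containing `5` does not contain `3`. [cite: DupuyHilado2025, §2.5.4] -/
theorem three_notMem {V : HeightOneSpectrum (𝓞 F)} (hV : (5 : 𝓞 F) ∈ V.asIdeal) : (3 : 𝓞 F) ∉ V.asIdeal := by
  intro h3
  apply V.isPrime.ne_top
  rw [Ideal.eq_top_iff_one]
  have : (1 : 𝓞 F) = 2 * 3 - 5 := by norm_num
  rw [this]
  exact V.asIdeal.sub_mem (V.asIdeal.mul_mem_left _ h3) hV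

omit [NumberField F] in
/-- A place containing `π` does not contain `π̄` (`π + π̄ = 4`, `5 − 4 = 1`). [cite: IrelandRosen1982, Ch. 9 §7 p. 120] -/
theorem piBar_notMem (hζ : IsPrimitiveRoot ζ 4) {V : HeightOneSpectrum (𝓞 F)} (hV : (2 + ζ : 𝓞 F) ∈ V.asIdeal) :
    (2 - ζ : 𝓞 F) ∉ V.asIdeal := by
  intro h
  apply V.isPrime.ne_top
  rw [Ideal.eq_top_iff_one]
  have e : (1 : 𝓞 F) = 5 - ((2 + ζ) + (2 - ζ)) := by ring
  rw [e]
  exact V.asIdeal.sub_mem (five_mem hζ hV) (V.asIdeal.add_mem hV h)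

omit [NumberField F] in
/-- Symmetrically, a place containing `π̄` does not contain `π`. [cite: IrelandRosen1982, Ch. 9 §7 p. 120] -/
theorem pi_notMem (hζ : IsPrimitiveRoot ζ 4) {W : HeightOneSpectrum (𝓞 F)} (hW : (2 - ζ : 𝓞 F) ∈ W.asIdeal) :
    (2 + ζ : 𝓞 F) ∉ W.asIdeal :=
  fun h => piBar_notMem hζ h hW

/-- A prime `l ≠ 5` is not in a place containing `5`. [cite: DupuyHilado2025, §2.5.4] -/
theorem natCast_notMem {V : HeightOneSpectrum (𝓞 F)} (hV : (5 : 𝓞 F) ∈ V.asIdeal) {l : ℕ} (hl : l.Prime)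
    (hl5 : l ≠ 5) : (l : 𝓞 F) ∉ V.asIdeal := by
  haveI : Fact (Nat.Prime 5) := ⟨by norm_num⟩
  exact SplitDepth.natCast_not_mem_of_prime_ne ⟨V, mem_placesOver_five hV⟩ hl hl5

/-! ## The conjugate place `W = V̄ ∋ π̄` and the congruences `π^{2k} ≡ 1 (mod W)` -/

omit [NumberField F] in
/-- `π̄ ∈ V̄`. [cite: IrelandRosen1982, Ch. 9 §7 p. 120] -/
theorem piBar_mem_comap (τ : 𝓞 F ≃ₐ[ℤ] 𝓞 F) (hτ : τ ζ = -ζ) {V : HeightOneSpectrum (𝓞 F)}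
    (hV : (2 + ζ : 𝓞 F) ∈ V.asIdeal) :
    (2 - ζ : 𝓞 F) ∈ (HeightOneSpectrum.comap (τ : 𝓞 F →+* 𝓞 F) τ.surjective V).asIdeal := by
  rw [mem_comap_iff, map_sub, map_ofNat, hτ, sub_neg_eq_add]
  exact hV

omit [NumberField F] in
/-- `π^{2k} − 1 ∈ W` for every place `W ∋ π̄` (`π² − 1 = 2(5 − 2π̄) ∈ W` and `π² − 1 ∣ π^{2k} − 1`).
[cite: IrelandRosen1982, Ch. 9 §7 p. 120] -/
theorem pi_pow_sub_one_mem (hζ : IsPrimitiveRoot ζ 4) {W : HeightOneSpectrum (𝓞 F)} (hW : (2 - ζ : 𝓞 F) ∈ W.asIdeal)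
    (k : ℕ) : ((2 + ζ) ^ (2 * k) - 1 : 𝓞 F) ∈ W.asIdeal := by
  have h1 : ((2 + ζ) ^ 2 - 1 : 𝓞 F) ∈ W.asIdeal := by
    rw [pi_sq_sub_one hζ]
    refine W.asIdeal.mul_mem_left _ (W.asIdeal.sub_mem (five_mem' hζ hW) (W.asIdeal.mul_mem_left _ hW))
  have hdvd : ((2 + ζ) ^ 2 - 1 : 𝓞 F) ∣ (2 + ζ) ^ (2 * k) - 1 := by
    have := sub_dvd_pow_sub_pow ((2 + ζ) ^ 2 : 𝓞 F) 1 k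
    rwa [one_pow, ← pow_mul] at this
  obtain ⟨d, hd⟩ := hdvd
  rw [hd]
  exact W.asIdeal.mul_mem_right _ h1

omit [NumberField F] in
/-- `b = 2π^{2k} + 1 ∉ W` (`b = 2(π^{2k} − 1) + 3` and `3 ∉ W`). [cite: IrelandRosen1982, Ch. 9 §7 p. 120] -/
theorem b_notMem_W (hζ : IsPrimitiveRoot ζ 4) {W : HeightOneSpectrum (𝓞 F)} (hW : (2 - ζ : 𝓞 F) ∈ W.asIdeal)
    (k : ℕ) : (2 * (2 + ζ) ^ (2 * k) + 1 : 𝓞 F) ∉ W.asIdeal := by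
  intro h
  have h3 : (3 : 𝓞 F) ∈ W.asIdeal := by
    have e : (3 : 𝓞 F) = (2 * (2 + ζ) ^ (2 * k) + 1) - 2 * ((2 + ζ) ^ (2 * k) - 1) := by ring
    rw [e]
    exact W.asIdeal.sub_mem h (W.asIdeal.mul_mem_left _ (pi_pow_sub_one_mem hζ hW k))
  exact three_notMem (five_mem' hζ hW) h3

omit [NumberField F] in
/-- `c = π^{2k} + 1 ∉ W` (`c = (π^{2k} − 1) + 2` and `2 ∉ W`). [cite: IrelandRosen1982, Ch. 9 §7 p. 120] -/
theorem c_notMem_W (hζ : IsPrimitiveRoot ζ 4) {W : HeightOneSpectrum (𝓞 F)} (hW : (2 - ζ : 𝓞 F) ∈ W.asIdeal)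
    (k : ℕ) : ((2 + ζ) ^ (2 * k) + 1 : 𝓞 F) ∉ W.asIdeal := by
  intro h
  have h2 : (2 : 𝓞 F) ∈ W.asIdeal := by
    have e : (2 : 𝓞 F) = ((2 + ζ) ^ (2 * k) + 1) - ((2 + ζ) ^ (2 * k) - 1) := by ring
    rw [e]
    exact W.asIdeal.sub_mem h (pi_pow_sub_one_mem hζ hW k)
  exact two_notMem (five_mem' hζ hW) h2

omit [NumberField F] in
/-- `π^{n} ∉ W`. [cite: IrelandRosen1982, Ch. 9 §7 p. 120] -/
theorem a_notMem_W (hζ : IsPrimitiveRoot ζ 4) {W : HeightOneSpectrum (𝓞 F)} (hW : (2 - ζ : 𝓞 F) ∈ W.asIdeal)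
    (n : ℕ) : ((2 + ζ) ^ n : 𝓞 F) ∉ W.asIdeal :=
  fun h => pi_notMem hζ hW (W.isPrime.mem_of_pow_mem n h)

omit [NumberField F] in
/-- `b = 2π^{2k} + 1 ∉ V` for `V ∋ π`, `k ≥ 1`. [cite: IrelandRosen1982, Ch. 9 §7 p. 120] -/
theorem b_notMem_V {V : HeightOneSpectrum (𝓞 F)} (hV : (2 + ζ : 𝓞 F) ∈ V.asIdeal)
    {k : ℕ} (hk : 1 ≤ k) : (2 * (2 + ζ) ^ (2 * k) + 1 : 𝓞 F) ∉ V.asIdeal := by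
  intro h
  apply V.isPrime.ne_top
  rw [Ideal.eq_top_iff_one]
  have ha : ((2 + ζ) ^ (2 * k) : 𝓞 F) ∈ V.asIdeal := V.asIdeal.pow_mem_of_mem hV _ (by omega)
  have e : (1 : 𝓞 F) = (2 * (2 + ζ) ^ (2 * k) + 1) - 2 * (2 + ζ) ^ (2 * k) := by ring
  rw [e]
  exact V.asIdeal.sub_mem h (V.asIdeal.mul_mem_left _ ha)

omit [NumberField F] in
/-- `c = π^{2k} + 1 ∉ V` for `V ∋ π`, `k ≥ 1`. [cite: IrelandRosen1982, Ch. 9 §7 p. 120] -/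
theorem c_notMem_V {V : HeightOneSpectrum (𝓞 F)} (hV : (2 + ζ : 𝓞 F) ∈ V.asIdeal)
    {k : ℕ} (hk : 1 ≤ k) : ((2 + ζ) ^ (2 * k) + 1 : 𝓞 F) ∉ V.asIdeal := by
  intro h
  apply V.isPrime.ne_top
  rw [Ideal.eq_top_iff_one]
  have ha : ((2 + ζ) ^ (2 * k) : 𝓞 F) ∈ V.asIdeal := V.asIdeal.pow_mem_of_mem hV _ (by omega)
  have e : (1 : 𝓞 F) = ((2 + ζ) ^ (2 * k) + 1) - (2 + ζ) ^ (2 * k) := by ring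
  rw [e]
  exact V.asIdeal.sub_mem h ha

/-! ## The point `λ_k = a/b`, `a = π^{2k}`, `b = 2a + 1`, `1 − λ_k = c/b`, `c = a + 1` -/

/-- `b ≠ 0` and `c ≠ 0` in `𝓞 F`. [cite: IrelandRosen1982, Ch. 9 §7 p. 120] -/
theorem b_ne_zero [IsCyclotomicExtension {4} ℚ F] (hζ : IsPrimitiveRoot ζ 4) {k : ℕ} (hk : 1 ≤ k) :
    (2 * (2 + ζ) ^ (2 * k) + 1 : 𝓞 F) ≠ 0 ∧ ((2 + ζ) ^ (2 * k) + 1 : 𝓞 F) ≠ 0 := by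
  obtain ⟨V, hV⟩ := exists_place_pi hζ
  exact ⟨fun h => b_notMem_V hV hk (h ▸ V.asIdeal.zero_mem), fun h => c_notMem_V hV hk (h ▸ V.asIdeal.zero_mem)⟩

/-- `b ≠ 0` in `F`. [cite: IrelandRosen1982, Ch. 9 §7 p. 120] -/
theorem bF_ne_zero [IsCyclotomicExtension {4} ℚ F] (hζ : IsPrimitiveRoot ζ 4) {k : ℕ} (hk : 1 ≤ k) :
    (2 * (2 + (ζ : F)) ^ (2 * k) + 1) ≠ 0 := by
  rw [← coe_b]; exact fun h => (b_ne_zero hζ hk).1 (by exact_mod_cast h)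

/-- `c ≠ 0` in `F`. [cite: IrelandRosen1982, Ch. 9 §7 p. 120] -/
theorem cF_ne_zero [IsCyclotomicExtension {4} ℚ F] (hζ : IsPrimitiveRoot ζ 4) {k : ℕ} (hk : 1 ≤ k) :
    ((2 + (ζ : F)) ^ (2 * k) + 1) ≠ 0 := by
  rw [← coe_c]; exact fun h => (b_ne_zero hζ hk).2 (by exact_mod_cast h)

/-- `λ_k ≠ 0`. [cite: MochizukiGenEll2010, Thm 2.1 (ii) p.11] -/
theorem lam_ne_zero [IsCyclotomicExtension {4} ℚ F] (hζ : IsPrimitiveRoot ζ 4) {k : ℕ} (hk : 1 ≤ k) :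
    (2 + (ζ : F)) ^ (2 * k) / (2 * (2 + (ζ : F)) ^ (2 * k) + 1) ≠ 0 :=
  div_ne_zero (pow_ne_zero _ (piF_ne_zero hζ)) (bF_ne_zero hζ hk)

/-- `1 − λ_k = c/b`. [cite: IrelandRosen1982, Ch. 9 §7 p. 120] -/
theorem one_sub_lam [IsCyclotomicExtension {4} ℚ F] (hζ : IsPrimitiveRoot ζ 4) {k : ℕ} (hk : 1 ≤ k) :
    1 - (2 + (ζ : F)) ^ (2 * k) / (2 * (2 + (ζ : F)) ^ (2 * k) + 1) =
      ((2 + (ζ : F)) ^ (2 * k) + 1) / (2 * (2 + (ζ : F)) ^ (2 * k) + 1) := by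
  have hb := bF_ne_zero hζ hk
  rw [eq_div_iff hb, sub_mul, div_mul_cancel₀ _ hb]
  ring

/-- `λ_k ≠ 1`. [cite: MochizukiGenEll2010, Thm 2.1 (ii) p.11] -/
theorem lam_ne_one [IsCyclotomicExtension {4} ℚ F] (hζ : IsPrimitiveRoot ζ 4) {k : ℕ} (hk : 1 ≤ k) :
    (2 + (ζ : F)) ^ (2 * k) / (2 * (2 + (ζ : F)) ^ (2 * k) + 1) ≠ 1 := by
  intro h
  have h1 := one_sub_lam hζ hk
  rw [h, sub_self, eq_comm, div_eq_zero_iff] at h1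
  rcases h1 with h1 | h1
  · exact cF_ne_zero hζ hk h1
  · exact bF_ne_zero hζ hk h1

/-- `λ_k − 1/2 = −1/(2b)`. [cite: IrelandRosen1982, Ch. 9 §7 p. 120] -/
theorem lam_sub_half [IsCyclotomicExtension {4} ℚ F] (hζ : IsPrimitiveRoot ζ 4) {k : ℕ} (hk : 1 ≤ k) :
    (2 + (ζ : F)) ^ (2 * k) / (2 * (2 + (ζ : F)) ^ (2 * k) + 1) - 2⁻¹ =
      -(2 * (2 * (2 + (ζ : F)) ^ (2 * k) + 1))⁻¹ := by
  have hb := bF_ne_zero hζ hk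
  field_simp
  ring

end LopsidedWitness

end Summit.ABC.IUTFork

end
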